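import Mathlib
import Summits.ValiantsHypothesis.ValiantsHypothesis.Theorems.BarrierLeverPartitionMinorsHitByVPHiddenStatesSecondShellConfigurations

/-!
# Route BarrierLever — item `PartitionMinorsHitByVP` (stmt-ValiantsHypothesis-19717), line `hidden-states`:
# ★★ TWO FORCED COLLIDERS — an abstract discharge of the master template's «no reduced configuration» hypothesis

Helper file (`--supports stmt-ValiantsHypothesis-19717`; cell valiant-natproofs, 𝒟-side door (c), registered line
`Cruxes/PartitionMinorsHitByVP/Lines/hidden_states.lean` v9; prover seat val-np-p6 gen 20).  Closes NO item; definition-free.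

THE LEMMA (memo HOME/val-np-p6/g20/MEMO-valnp6-g20.md §2).  In the configuration language of
`…SecondShellMasterTemplate.exists_table_secondShell_of_noReduced` (tokens on `C`, targets `A`, edge relation `E`, one-collision first
steps `f`, path successor map `g`), a token `u ∈ C ∖ A` is FORCED (must be one of the two colliding tokens of a reduced configuration) if
* (SOURCE) nobody can enter it: `∀ w, ¬ E w u`, or
* (BLOCKED) every out-neighbour is DEAD (outside `A`, no out-edge), an IMMOBILE TOKEN (in `A ∩ C`, no out-edge) or lies in a set `Uok`
  with at most one element.
★★ `exists_active_of_source_of_blocked`: a source `u₁` and a blocked `u₂ ≠ u₁` such that `u₁` cannot step onto `u₂` unless `Uok = ∅`, and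
cannot step onto `Uok`, force an ACTIVE token — i.e. the hypothesis `hnone` of the master template holds for that cross minor.
This one lemma discharges the three new orientation cells of the ∀t second-shell theorem (blocked bottom `a`, blocked bottom `c`,
equal-Y blocked level; memo §3), each of which only has to compute two neighbourhoods of its union digraph.

HONEST LABEL: conjecture-column toolkit (second shell, every `t, h`); 19717 stays OPEN; nothing on crux 14610 or VP ≠ VNP.
-/

set_option linter.dupNamespace false

namespace Summit.ValiantsHypothesis.ValiantsHypothesis.Theorems.BarrierLever.HiddenStates

open Finset

noncomputable section

namespace SecondShell

variable {ι : Type} [Fintype ι] [DecidableEq ι]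

omit [Fintype ι] in
/-- erasing one of two points with the same image does not change the image. -/
theorem image_erase_eq_of_eq (s : Finset ι) (f : ι → ι) {a b : ι} (hb : b ∈ s) (hab : a ≠ b)
    (hf : f a = f b) : (s.erase a).image f = s.image f := by
  ext v
  simp only [Finset.mem_image, Finset.mem_erase]
  constructor
  · rintro ⟨x, ⟨-, hx⟩, rfl⟩; exact ⟨x, hx, rfl⟩
  · rintro ⟨x, hx, rfl⟩
    by_cases hxa : x = a
    · exact ⟨b, ⟨Ne.symm hab, hb⟩, by rw [hxa, hf]⟩
    · exact ⟨x, ⟨hxa, hx⟩, rfl⟩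

omit [Fintype ι] in
/-- **one collision only**: if `|C.image f| + 1 = |C|` and two tokens `u₁, u₂` both collide, they collide with each other. -/
theorem eq_of_two_colliding (C : Finset ι) (f : ι → ι) {t : ℕ} (hC : C.card = t + 1) (h3 : (C.image f).card = t)
    {u₁ u₂ : ι} (hu₁ : u₁ ∈ C) (hu₂ : u₂ ∈ C)
    (hc₁ : f u₁ ∈ (C.erase u₁).image f) (hc₂ : f u₂ ∈ (C.erase u₂).image f) : f u₁ = f u₂ := by
  by_contra hf
  obtain ⟨u₁', hu₁', hf₁⟩ := Finset.mem_image.1 hc₁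
  obtain ⟨u₂', hu₂', hf₂⟩ := Finset.mem_image.1 hc₂
  rw [Finset.mem_erase] at hu₁' hu₂'
  -- erase `u₁'` and `u₂'`: the image does not change
  have hne₁₂' : u₁' ≠ u₂' := fun h => hf (by rw [← hf₁, h, hf₂])
  have hu₂u₁' : u₂ ≠ u₁' := fun h => hf (by rw [← hf₁, ← h])
  have h1 : (C.erase u₁').image f = C.image f := image_erase_eq_of_eq C f hu₁ hu₁'.1 hf₁
  have hu₂m : u₂ ∈ C.erase u₁' := Finset.mem_erase.2 ⟨hu₂u₁', hu₂⟩
  have h2 : ((C.erase u₁').erase u₂').image f = (C.erase u₁').image f :=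
    image_erase_eq_of_eq (C.erase u₁') f hu₂m hu₂'.1 hf₂
  have hcard : ((C.erase u₁').erase u₂').card = t - 1 := by
    rw [Finset.card_erase_of_mem (Finset.mem_erase.2 ⟨Ne.symm hne₁₂', hu₂'.2⟩), Finset.card_erase_of_mem hu₁'.2, hC]
    omega
  have hle : (C.image f).card ≤ t - 1 := by
    rw [← h1, ← h2]; exact Finset.card_image_le.trans (le_of_eq hcard)
  have ht : 1 ≤ t := by
    have : 0 < (C.image f).card := Finset.card_pos.2 ⟨f u₁, Finset.mem_image_of_mem f hu₁⟩
    omega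
  omega

omit [Fintype ι] in
/-- **the fibre of the collision has exactly two tokens**: a third token with the same image is impossible. -/
theorem false_of_third_colliding (C : Finset ι) (f : ι → ι) {t : ℕ} (hC : C.card = t + 1) (h3 : (C.image f).card = t)
    {u₁ u₂ u₃ : ι} (hu₁ : u₁ ∈ C) (hu₂ : u₂ ∈ C) (hu₃ : u₃ ∈ C) (h₁₂ : u₁ ≠ u₂) (h₁₃ : u₁ ≠ u₃) (h₂₃ : u₂ ≠ u₃)
    (hf₂ : f u₂ = f u₁) (hf₃ : f u₃ = f u₁) : False := by
  have h1 : (C.erase u₂).image f = C.image f := image_erase_eq_of_eq C f hu₁ (Ne.symm h₁₂) hf₂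
  have hu₁m : u₁ ∈ C.erase u₂ := Finset.mem_erase.2 ⟨h₁₂, hu₁⟩
  have h2 : ((C.erase u₂).erase u₃).image f = (C.erase u₂).image f :=
    image_erase_eq_of_eq (C.erase u₂) f hu₁m (Ne.symm h₁₃) hf₃
  have hcard : ((C.erase u₂).erase u₃).card = t - 1 := by
    rw [Finset.card_erase_of_mem (Finset.mem_erase.2 ⟨Ne.symm h₂₃, hu₃⟩), Finset.card_erase_of_mem hu₂, hC]
    omega
  have hle : (C.image f).card ≤ t - 1 := by
    rw [← h1, ← h2]; exact Finset.card_image_le.trans (le_of_eq hcard)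
  have ht : 1 ≤ t := by
    have : 0 < (C.image f).card := Finset.card_pos.2 ⟨f u₁, Finset.mem_image_of_mem f hu₁⟩
    omega
  omega

/-- ★★ **TWO FORCED COLLIDERS.**  In a configuration `(f, g)` for the cross minor with tokens `C` (`|C| = t+1`), targets `A` and edge
relation `E` (hypotheses `h0 … h6` verbatim as in the master template, with `E` for the table's support): a SOURCE token
`u₁ ∈ C ∖ A` (nobody's out-neighbour) and a BLOCKED token `u₂ ∈ C ∖ A` (each out-neighbour dead, an immobile token, or in `Uok`,
`|Uok| ≤ 1`), such that `u₁` does not step onto `u₂` unless `Uok = ∅` and never steps onto `Uok`, force an ACTIVE token. -/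
theorem exists_active_of_source_of_blocked (E : ι → ι → Prop) (C A : Finset ι) {t : ℕ} (hC : C.card = t + 1)
    (f g : ι → ι) (h0 : ∀ u, u ∉ C → f u = u) (h1 : ∀ u ∈ C, f u ≠ u → E u (f u)) (h2 : ∀ u, g u ≠ u → E u (g u))
    (h3 : (C.image f).card = t) (h4 : Disjoint (mov g) A) (h5 : C.image f ⊆ A ∪ mov g)
    (h6 : (mov g).image g = (A ∪ mov g) \ C.image f)
    {u₁ u₂ : ι} (hu₁C : u₁ ∈ C) (hu₁A : u₁ ∉ A) (hu₂C : u₂ ∈ C) (hu₂A : u₂ ∉ A) (hne : u₁ ≠ u₂)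
    (hsrc : ∀ w, ¬ E w u₁) (Uok : Finset ι) (hUok : Uok.card ≤ 1)
    (hout : ∀ v, E u₂ v → v ∈ Uok ∨ (v ∉ A ∧ ∀ w, ¬ E v w) ∨ (v ∈ A ∧ v ∈ C ∧ ∀ w, ¬ E v w))
    (hI₁ : E u₁ u₂ → Uok = ∅) (hI₂ : ∀ v ∈ Uok, ¬ E u₁ v) :
    ∃ u ∈ C, u ∉ A ∧ f u ∉ (C.erase u).image f ∧ (f u = u ↔ g u ≠ u) := by
  classical
  have _ := h0; have _ := h4
  -- basic facts about the configuration
  have hmov : ∀ u, u ∈ mov g ↔ g u ≠ u := fun u => by simp [mov]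
  have himgA : ∀ u ∈ C, f u ∉ A → f u ∈ mov g := by
    intro u hu hA
    have := h5 (Finset.mem_image_of_mem f hu)
    rcases Finset.mem_union.1 this with h | h
    · exact (hA h).elim
    · exact h
  have hgimg : ∀ w, g w ≠ w → g w ∉ C.image f ∧ g w ∈ A ∪ mov g := by
    intro w hw
    have : g w ∈ (mov g).image g := Finset.mem_image_of_mem g ((hmov w).2 hw)
    rw [h6, Finset.mem_sdiff] at this
    exact ⟨this.2, this.1⟩
  -- an element of `mov g` outside the image is entered by a path edge
  have hentered : ∀ u, g u ≠ u → u ∉ C.image f → ∃ w, g w ≠ w ∧ g w = u := by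
    intro u hu hni
    have : u ∈ (A ∪ mov g) \ C.image f :=
      Finset.mem_sdiff.2 ⟨Finset.mem_union_right _ ((hmov u).2 hu), hni⟩
    rw [← h6] at this
    obtain ⟨w, hw, hwu⟩ := Finset.mem_image.1 this
    exact ⟨w, (hmov w).1 hw, hwu⟩
  -- a dead vertex is never in the image; an immobile token stays
  have hdead : ∀ v, v ∉ A → (∀ w, ¬ E v w) → v ∉ C.image f := by
    intro v hvA hvd hv
    have hvm : v ∈ mov g := by
      rcases Finset.mem_union.1 (h5 hv) with h | h
      · exact (hvA h).elim
      · exact h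
    exact hvd _ (h2 v ((hmov v).1 hvm))
  have himm : ∀ v, v ∈ C → (∀ w, ¬ E v w) → f v = v := by
    intro v hvC hvd
    by_contra h
    exact hvd _ (h1 v hvC h)
  by_contra hcon
  push Not at hcon
  -- `hcon u hu huA hnc : ¬ (f u = u ↔ g u ≠ u)` for non-colliding outside tokens
  -- Step 1: the source collides
  have hc₁ : f u₁ ∈ (C.erase u₁).image f := by
    by_contra hnc
    rcases hcon u₁ hu₁C hu₁A hnc with ⟨hf, hg⟩ | ⟨hf, hg⟩
    · have hm : u₁ ∈ mov g := by have := himgA u₁ hu₁C (by rw [hf]; exact hu₁A); rwa [hf] at this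
      exact (hmov u₁).1 hm hg
    · -- `u₁` is not in the image (nobody steps onto a source)
      have hni : u₁ ∉ C.image f := by
        intro h
        obtain ⟨u', hu', hfu'⟩ := Finset.mem_image.1 h
        have hne' : f u' ≠ u' := by
          intro h'
          have : u' = u₁ := h'.symm.trans hfu'
          rw [this] at h'
          exact hf h'
        exact hsrc u' (hfu' ▸ h1 u' hu' hne')
      obtain ⟨w, hw, hwu⟩ := hentered u₁ hg hni
      exact hsrc w (hwu ▸ h2 w hw)
  -- Step 2: the blocked token collides
  have hc₂ : f u₂ ∈ (C.erase u₂).image f := by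
    by_contra hnc
    rcases hcon u₂ hu₂C hu₂A hnc with ⟨hf, hg⟩ | ⟨hf, hg⟩
    · have hm : u₂ ∈ mov g := by have := himgA u₂ hu₂C (by rw [hf]; exact hu₂A); rwa [hf] at this
      exact (hmov u₂).1 hm hg
    · have hEv : E u₂ (f u₂) := h1 u₂ hu₂C hf
      have hEw : E u₂ (g u₂) := h2 u₂ hg
      obtain ⟨hwni, hwAm⟩ := hgimg u₂ hg
      have hvimg : f u₂ ∈ C.image f := Finset.mem_image_of_mem f hu₂C
      have hvw : f u₂ ≠ g u₂ := fun h => hwni (h ▸ hvimg)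
      -- `f u₂ ∈ Uok`
      have hv : f u₂ ∈ Uok := by
        rcases hout _ hEv with h | ⟨hvA, hvd⟩ | ⟨hvA, hvC, hvd⟩
        · exact h
        · exact (hdead _ hvA hvd hvimg).elim
        · exfalso
          have hfv : f (f u₂) = f u₂ := himm _ hvC hvd
          have hvne : f u₂ ≠ u₂ := hf
          exact hnc (Finset.mem_image.2 ⟨f u₂, Finset.mem_erase.2 ⟨hvne, hvC⟩, hfv⟩)
      -- `g u₂ ∈ Uok`
      have hw : g u₂ ∈ Uok := by
        rcases hout _ hEw with h | ⟨hwA, hwd⟩ | ⟨hwA, hwC, hwd⟩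
        · exact h
        · exfalso
          have hwm : g u₂ ∈ mov g := by
            rcases Finset.mem_union.1 hwAm with h | h
            · exact (hwA h).elim
            · exact h
          exact hwd _ (h2 _ ((hmov _).1 hwm))
        · exfalso
          have hfw : f (g u₂) = g u₂ := himm _ hwC hwd
          exact hwni (Finset.mem_image.2 ⟨g u₂, hwC, hfw⟩)
      have h2le : 2 ≤ Uok.card := by
        have : ({f u₂, g u₂} : Finset ι) ⊆ Uok := by
          intro x hx
          rcases Finset.mem_insert.1 hx with rfl | hx
          · exact hv
          · rw [Finset.mem_singleton] at hx; rw [hx]; exact hw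
        have hc : ({f u₂, g u₂} : Finset ι).card = 2 := Finset.card_pair hvw
        exact hc ▸ Finset.card_le_card this
      omega
  -- Step 3: they collide with each other, and nobody else does
  have hff : f u₁ = f u₂ := eq_of_two_colliding C f hC h3 hu₁C hu₂C hc₁ hc₂
  -- Step 4: the source moved
  have hf₁ : f u₁ ≠ u₁ := by
    intro h
    have hf₂ : f u₂ ≠ u₂ := by rw [← hff, h]; exact hne
    exact hsrc u₂ (by have := h1 u₂ hu₂C hf₂; rwa [← hff, h] at this)
  have hE₁ : E u₁ (f u₁) := h1 u₁ hu₁C hf₁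
  by_cases hf₂ : f u₂ = u₂
  · -- collision at `u₂` itself: `Uok = ∅`, and the merged token cannot continue
    have hE12 : E u₁ u₂ := by rw [hff, hf₂] at hE₁; exact hE₁
    have hU0 : Uok = ∅ := hI₁ hE12
    have hm : u₂ ∈ mov g := by have := himgA u₂ hu₂C (by rw [hf₂]; exact hu₂A); rwa [hf₂] at this
    have hg : g u₂ ≠ u₂ := (hmov u₂).1 hm
    have hEw : E u₂ (g u₂) := h2 u₂ hg
    obtain ⟨hwni, hwAm⟩ := hgimg u₂ hg
    rcases hout _ hEw with h | ⟨hwA, hwd⟩ | ⟨hwA, hwC, hwd⟩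
    · rw [hU0] at h; simp at h
    · have hwm : g u₂ ∈ mov g := by
        rcases Finset.mem_union.1 hwAm with h | h
        · exact (hwA h).elim
        · exact h
      exact hwd _ (h2 _ ((hmov _).1 hwm))
    · exact hwni (Finset.mem_image.2 ⟨g u₂, hwC, himm _ hwC hwd⟩)
  · have hE₂ : E u₂ (f u₂) := h1 u₂ hu₂C hf₂
    have hvimg : f u₂ ∈ C.image f := Finset.mem_image_of_mem f hu₂C
    rcases hout _ hE₂ with h | ⟨hvA, hvd⟩ | ⟨hvA, hvC, hvd⟩
    · exact hI₂ _ h (hff ▸ hE₁)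
    · exact hdead _ hvA hvd hvimg
    · -- an immobile token at the collision point would be a third collider
      have hfv : f (f u₂) = f u₂ := himm _ hvC hvd
      have hv₁ : u₁ ≠ f u₂ := fun h => hu₁A (h ▸ hvA)
      have hv₂ : u₂ ≠ f u₂ := fun h => hu₂A (h ▸ hvA)
      exact false_of_third_colliding C f hC h3 hu₁C hu₂C hvC hne hv₁ hv₂ hff.symm (by rw [hfv, hff])

end SecondShell

end

end Summit.ValiantsHypothesis.ValiantsHypothesis.Theorems.BarrierLever.HiddenStates
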